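import Summits.ABC.IUTFork.Conditional.GenuineKExactTameLocalTypeOfNotSquare
import Summits.ABC.IUTFork.Conditional.WRowFrey73NineteenInhabitedHalf
import HarnessLib

/-!
# R-W WINDOW-TABLE «W:FREY73-L19-CONVERSE» — at `73 + 2¹³·7⁷·941² = 3¹⁶·103³·127` the Kummer type over `7` is
# `570 ⟺ √(λ−1) ∈ F` and `285 ⟸ √(λ−1) ∉ F`; at `l = 19`: `√(λ−1) ∉ F` ⟹ ¬S_H (the REFUTED half keyed to the model clause)

PROOF-ONLY file (D-0012; 0 definitions, 0 `Prop` facts, no instance) of the abc-iut cell — D-0079 RESCUE sub-cell R-W «WINDOW Θ-SIDE INEQUALITY»,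
row «W:FREY73-L19-CONVERSE» = abc-iut-plan ruling C-R89 (a)(ii) «the converse `√(λ−1) ∉ F ⇒ e₇ = 285` as a theorem (IsSubThetaField generator
analysis)», seat abc-iut-L6-t15 (gen 14); file 2/2 (file 1/2 = `Conditional/GenuineKExactTameLocalTypeOfNotSquare`). TAKES NO SIDE on
[IUTchIII] Cor. 3.12 (S. Mochizuki, *Inter-universal Teichmüller theory III*, Cor. 3.12 p. 173–174; Step (xi-f) p. 184) or on any author;
«refuted as typed» ≠ «asserted in print».

CONTEXT. abc-iut-W-row-1's `WRowFrey73NineteenRefutedHalf` / `…InhabitedHalf` (p494541 / p495544) decide the hull-level clause S_H at the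
`73`-triple, `l = 19`, by the Kummer type over `7`: REFUTED at every genuine datum with `e(K_{x₀}/ℚ_7) = 285`, INHABITED at every datum with
`e = 570`, and «`√(λ−1) ∈ F` ⟹ `570`» (abc-iut-W-neg-2's `GenuineK.absRamificationIdx_kOf_eq_thirty_mul_of_isSquare`, `ord_7(λ−1) = 7` odd).
THIS FILE supplies the converse at the datum (`λ = 73/5973865915867209`: `ord_7 λ = 0`, `ord_7(λ−1) = 7`, `ord_7 j = −14`, `gcd(15, 7) = 1`):

* **`WRow.absRamificationIdx_frey73_seven_eq_fifteen_mul_of_not_isSquare`** (`l ≠ 7`) — `¬ IsSquare (λ − 1)` in `T.F` ⟹ `e(K_{x₀}/ℚ_7) = 15·l`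
  at every `x₀ ∣ 7` (file 1's `GenuineK.absRamificationIdx_kOf_eq_fifteen_mul_of_sq_ne_sub_one` at `p = 7`, `t = 7`);
* **`WRow.absRamificationIdx_frey73_seven_eq_thirty_mul_iff_isSquare`** (`l ≠ 7`) — **`e(K_{x₀}/ℚ_7) = 30·l ⟺ IsSquare (λ − 1)`**, pointwise
  on the fibre: the twist bit in BOTH directions;
* at `l = 19`: **`WRow.absRamificationIdx_frey73_seven_eq_285_of_not_isSquare`**, **`WRow.not_licence_frey73_nineteen_of_not_isSquare`**,
  **`WRow.not_exists_qPinned_and_hull_frey73_nineteen_of_not_isSquare`** (∘ abc-iut-W-row-1's `…_of_localType15` p494541 BY NAME) — the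
  REFUTED half keyed to the SAME model clause as the inhabited half `WRow.licence_frey73_nineteen_of_isSquare` (p495544): the TYPE-SPLIT bit
  at `l = 19` is `IsSquare (λ − 1)` in `F`, both directions in kernel.
NOT claimed: which admissible `F` print intends; non-emptiness / admissibility of either sub-class (C-R89 (a)(iii), untouched); the `M`-line twin
(C-R89 (a)(i)). HONEST SCOPE: OUR sharp containers; STRONGER-THAN-PRINT hull reading; nothing about the printed inequality, the number-level
corollary or any author's intended hull; typed ≠ proved; instantiated ≠ endorsed; no abc claim.
[cite: Mochizuki2012, IUTchI Def. 3.1 (b),(c) pp. 61–62, Ex. 3.2 (iv) p. 71; IUTchIII Cor. 3.12 Step (xi-f) p. 184; IUTchIV Thm. 1.10 p. 22 and proof Steps (ii)–(iii) p. 24–26, Cor. 2.2 (ii) proof (P5) p. 46]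
[cite: DupuyHilado2025, §3.4, §4.9, §4.12] [cite: SerreLocalFields1979, Ch. IV §2 Cor. 1 of Prop. 7] [claim: Mochizuki2012, status: disputed] for every IUT quotation.
-/

noncomputable section

open Set Function Metric NumberField IsDedekindDomain

namespace Summit.ABC.IUTFork.Conditional

open Thm311 Thm311.Real Cor312 Cor312Vol Cor312Prov Literature.IUT.LogThetaLattice Literature.IUT.LogVolume
  Literature.IUT.HodgeTheaters Literature.IUT.LogVolume.Cor22
open Literature.NumberTheory.NumberFields Literature.NumberTheory.GaloisRepresentations.Ultrametric
open Literature.NumberTheory.DiophantineGeometry Literature.NumberTheory.DiophantineGeometry.GenEll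

/-! ## §3. The `73`-triple `73 + 2¹³·7⁷·941² = 3¹⁶·103³·127` at the pole `7 ∣ b`: the twist bit IS `√(λ−1) ∈ F`, both directions -/

/-- `ord_7(λ − 1) = 7` for `λ = 73/5973865915867209` (`λ − 1 = −2¹³7⁷941²/(3¹⁶103³127)`), at the place of `ℚ` over `7`: ODD
(re-derivation of abc-iut-W-row-1's private `ord_seven_lam_sub_one`, WRowFrey73NineteenInhabitedHalf.lean). [folklore] -/
private theorem ord_seven_lam_sub_one' (v : HeightOneSpectrum (𝓞 ℚ))
    (hv : Rat.HeightOneSpectrum.natGenerator v = ((⟨7, by norm_num⟩ : Nat.Primes) : ℕ)) :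
    Odd (ord ℚ v ((((73 : ℕ) : ℚ) / (5973865915867209 : ℕ)) - 1)) := by
  have hq0 : ((((73 : ℕ) : ℚ) / (5973865915867209 : ℕ)) - 1) ≠ 0 := by norm_num
  have hb : padicValNat 7 5973865915867136 = 7 := by
    have h : (5973865915867136 : ℕ) = 7 ^ 7 * 7253860352 := by norm_num
    rw [h, padicValNat.mul (by norm_num) (by norm_num), padicValNat.prime_pow, padicValNat.eq_zero_of_not_dvd (by norm_num)]
  have hc : padicValNat 7 5973865915867209 = 0 := padicValNat.eq_zero_of_not_dvd (by norm_num)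
  rw [GenuineK.ord_rat_eq_padicValRat v hq0, hv]
  rw [show ((((73 : ℕ) : ℚ) / (5973865915867209 : ℕ)) - 1) = -(((5973865915867136 : ℕ) : ℚ) / ((5973865915867209 : ℕ) : ℚ)) by norm_num,
    padicValRat.neg, padicValRat.div (by norm_num) (by norm_num), padicValRat.of_nat, padicValRat.of_nat]
  simp only [hb, hc]
  decide

/-- `|λ|_7 = 1` for `λ = 73/5973865915867209` (`7 ∤ 73`, `7 ∤ 3¹⁶·103³·127`): `ord_7 λ = 0` is EVEN. [folklore] -/
private theorem valuation_seven_lam (v : HeightOneSpectrum (𝓞 ℚ))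
    (hv : Rat.HeightOneSpectrum.natGenerator v = ((⟨7, by norm_num⟩ : Nat.Primes) : ℕ)) :
    v.valuation ℚ ((((73 : ℕ) : ℚ) / (5973865915867209 : ℕ))) = 1 := by
  have h73 : v.valuation ℚ ((73 : ℕ) : ℚ) = 1 :=
    (UniformABCConjecture.valuation_natCast_eq_one_iff v 73).2 (by rw [hv]; norm_num)
  have hc : v.valuation ℚ ((5973865915867209 : ℕ) : ℚ) = 1 :=
    (UniformABCConjecture.valuation_natCast_eq_one_iff v 5973865915867209).2 (by rw [hv]; norm_num)
  rw [map_div₀, h73, hc, div_one]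

/-- **`√(λ−1) ∉ F` ⟹ `e(K_{x₀}/ℚ_7) = 15·l`** (`l ≠ 7`) at every fibre point `x₀ ∣ 7` of a genuine Θ-volume datum over
`(ratPoint (73/5973865915867209), l)`: the CONVERSE of abc-iut-W-neg-2's «`√(λ−1) ∈ F` ⟹ `30·l`» at this datum (§2 at `p = 7 ∣ b`,
`t = 7`, `gcd(15, 7) = 1`, `ord_7 λ = 0`, pole order abc-iut-W-row-2's `WRow.ord_jInv_frey73`).
[cite: Mochizuki2012, IUTchIV Thm. 1.10 p. 22 and proof Steps (ii)–(iii) p. 24–26, Cor. 2.2 (ii) proof (P5) p. 46] [claim: Mochizuki2012, status: disputed] -/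
theorem WRow.absRamificationIdx_frey73_seven_eq_fifteen_mul_of_not_isSquare {l : ℕ}
    (T : Cor22.ThetaVolumeDatumAt (ratPoint (((73 : ℕ) : ℚ) / (5973865915867209 : ℕ))) l) (hl7 : 7 ≠ l)
    (hns : letI := T.instFieldF; letI := T.instAlgebraF
      ¬ IsSquare (algebraMap (ratPoint (((73 : ℕ) : ℚ) / (5973865915867209 : ℕ))).F T.F ((((73 : ℕ) : ℚ) / (5973865915867209 : ℕ) - 1 : ℚ)))) :
    letI := T.instFieldF; letI := T.instNumberFieldF; letI := T.instAlgebraF; letI := T.instFieldK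
    letI := T.instNumberFieldK; letI := T.instAlgebraK; letI := T.instFieldFbar; letI := T.instAlgebraFbar
    letI := T.instAlgebraKFbar; letI := T.instIsElliptic
    haveI : Fact (Nat.Prime 7) := ⟨by norm_num⟩
    ∀ x₀ : (thetaIndex (pilotDataOfK T.D T.K)).Fibre (.inr ⟨7, by norm_num⟩),
      absRamificationIdx 7 (kOf (pilotDataOfK T.D T.K) 7 x₀) = 15 * l := by
  letI := T.instFieldF; letI := T.instNumberFieldF; letI := T.instAlgebraF; letI := T.instFieldK
  letI := T.instNumberFieldK; letI := T.instAlgebraK; letI := T.instFieldFbar; letI := T.instAlgebraFbar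
  letI := T.instAlgebraKFbar; letI := T.instIsElliptic
  have hpole : ∀ v : HeightOneSpectrum (𝓞 ℚ), Rat.HeightOneSpectrum.natGenerator v = ((⟨7, by norm_num⟩ : Nat.Primes) : ℕ) →
      ord ℚ v (jInv (((73 : ℕ) : ℚ) / (5973865915867209 : ℕ))) = -(2 * ((7 : ℕ) : ℤ)) := by
    intro v hv
    rw [WRow.ord_jInv_frey73 v hv (Or.inr (Or.inl rfl))]
    norm_num
  exact GenuineK.absRamificationIdx_kOf_eq_fifteen_mul_of_sq_ne_sub_one T ⟨7, by norm_num⟩ (by norm_num) (by norm_num) (by norm_num) hl7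
    (by norm_num) hpole (by norm_num) valuation_seven_lam hns

/-- **The twist bit, both directions: `e(K_{x₀}/ℚ_7) = 30·l ⟺ √(λ−1) ∈ F`** (`l ≠ 7`), pointwise on the fibre over `7` of a genuine
Θ-volume datum over `(ratPoint (73/5973865915867209), l)` — (⟸) abc-iut-W-neg-2's `GenuineK.absRamificationIdx_kOf_eq_thirty_mul_of_isSquare`
(`ord_7(λ−1) = 7` odd); (⟹) the converse above (`15·l ≠ 30·l`).
[cite: Mochizuki2012, IUTchIV Thm. 1.10 p. 22 and proof Steps (ii)–(iii) p. 24–26, Cor. 2.2 (ii) proof (P5) p. 46] [cite: SerreLocalFields1979, Ch. IV §2 Cor. 1 of Prop. 7]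
[claim: Mochizuki2012, status: disputed] -/
theorem WRow.absRamificationIdx_frey73_seven_eq_thirty_mul_iff_isSquare {l : ℕ}
    (T : Cor22.ThetaVolumeDatumAt (ratPoint (((73 : ℕ) : ℚ) / (5973865915867209 : ℕ))) l) (hl7 : 7 ≠ l) :
    letI := T.instFieldF; letI := T.instNumberFieldF; letI := T.instAlgebraF; letI := T.instFieldK
    letI := T.instNumberFieldK; letI := T.instAlgebraK; letI := T.instFieldFbar; letI := T.instAlgebraFbar
    letI := T.instAlgebraKFbar; letI := T.instIsElliptic
    haveI : Fact (Nat.Prime 7) := ⟨by norm_num⟩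
    ∀ x₀ : (thetaIndex (pilotDataOfK T.D T.K)).Fibre (.inr ⟨7, by norm_num⟩),
      absRamificationIdx 7 (kOf (pilotDataOfK T.D T.K) 7 x₀) = 30 * l ↔
        IsSquare (algebraMap (ratPoint (((73 : ℕ) : ℚ) / (5973865915867209 : ℕ))).F T.F ((((73 : ℕ) : ℚ) / (5973865915867209 : ℕ) - 1 : ℚ))) := by
  letI := T.instFieldF; letI := T.instNumberFieldF; letI := T.instAlgebraF; letI := T.instFieldK
  letI := T.instNumberFieldK; letI := T.instAlgebraK; letI := T.instFieldFbar; letI := T.instAlgebraFbar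
  letI := T.instAlgebraKFbar; letI := T.instIsElliptic
  intro x₀
  constructor
  · intro h30
    by_contra hns
    have h15 := WRow.absRamificationIdx_frey73_seven_eq_fifteen_mul_of_not_isSquare T hl7 hns x₀
    rw [h15] at h30
    have hl : 0 < l := T.D.l_prime.pos
    omega
  · intro hsq
    have hpole : ∀ v : HeightOneSpectrum (𝓞 ℚ), Rat.HeightOneSpectrum.natGenerator v = ((⟨7, by norm_num⟩ : Nat.Primes) : ℕ) →
        ord ℚ v (jInv (((73 : ℕ) : ℚ) / (5973865915867209 : ℕ))) = -(2 * ((7 : ℕ) : ℤ)) := by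
      intro v hv
      rw [WRow.ord_jInv_frey73 v hv (Or.inr (Or.inl rfl))]
      norm_num
    have h := GenuineK.absRamificationIdx_kOf_eq_thirty_mul_of_isSquare T ⟨7, by norm_num⟩ (by norm_num) (by norm_num) (by norm_num) hl7
      (by norm_num) hpole (by norm_num) hsq ord_seven_lam_sub_one' x₀
    exact h

/-- **`l = 19`: `√(λ−1) ∉ F` ⟹ `e(K_{x₀}/ℚ_7) = 285`** at every fibre point `x₀ ∣ 7` — the hypothesis `hloc` of abc-iut-W-row-1's
`WRow.not_licence_frey73_nineteen_of_localType15` (p494541), now keyed to the MODEL CLAUSE alone.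
[cite: Mochizuki2012, IUTchIV Thm. 1.10 p. 22 and proof Steps (ii)–(iii) p. 24–26, Cor. 2.2 (ii) proof (P5) p. 46] [claim: Mochizuki2012, status: disputed] -/
theorem WRow.absRamificationIdx_frey73_seven_eq_285_of_not_isSquare
    (T : Cor22.ThetaVolumeDatumAt (ratPoint (((73 : ℕ) : ℚ) / (5973865915867209 : ℕ))) 19)
    (hns : letI := T.instFieldF; letI := T.instAlgebraF
      ¬ IsSquare (algebraMap (ratPoint (((73 : ℕ) : ℚ) / (5973865915867209 : ℕ))).F T.F ((((73 : ℕ) : ℚ) / (5973865915867209 : ℕ) - 1 : ℚ)))) :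
    letI := T.instFieldF; letI := T.instNumberFieldF; letI := T.instAlgebraF; letI := T.instFieldK
    letI := T.instNumberFieldK; letI := T.instAlgebraK; letI := T.instFieldFbar; letI := T.instAlgebraFbar
    letI := T.instAlgebraKFbar; letI := T.instIsElliptic
    haveI : Fact (Nat.Prime 7) := ⟨by norm_num⟩
    ∀ x₀ : (thetaIndex (pilotDataOfK T.D T.K)).Fibre (.inr ⟨7, by norm_num⟩),
      absRamificationIdx 7 (kOf (pilotDataOfK T.D T.K) 7 x₀) = 285 := by
  intro x₀
  have h := WRow.absRamificationIdx_frey73_seven_eq_fifteen_mul_of_not_isSquare T (by norm_num) hns x₀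
  norm_num at h
  exact h

/-- **`73 + 2¹³·7⁷·941² = 3¹⁶·103³·127` at `l = 19`: `√(λ−1) ∉ F` ⟹ the licence FAILS.** `T` a genuine Θ-volume datum at
`(ratPoint (73/5973865915867209), 19)` whose field `F` contains NO square root of `λ − 1` (e.g. `F = ℚ(√−1, √λ, E_λ[15])`-shaped sub-Θ fields);
Θ- and q-ideles REALISING the pilot divisors of `X := pilotDataOfK T.D T.K`. THEN abc-iut-c312-1's `Thm311ToCor312.Licence` FAILS at
abc-iut-c312-7's `settingPrVolSharp X …` — abc-iut-W-row-1's `WRow.not_licence_frey73_nineteen_of_localType15` (p494541) at the exact type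
`285` supplied by `WRow.absRamificationIdx_frey73_seven_eq_285_of_not_isSquare`. The MIRROR of `WRow.licence_frey73_nineteen_of_isSquare`
(p495544): the TYPE-SPLIT at `l = 19` is decided by the single model clause `IsSquare (λ − 1)` in `F`.
[cite: Mochizuki2012, IUTchI Ex. 3.2 (iv) p. 71; IUTchIII Cor. 3.12 Step (xi-f) p. 184; IUTchIV Prop. 1.1 p. 9, Prop. 1.2 (i)(ii) p. 10, Cor. 2.2 (ii) proof (P5) p. 46]
[cite: DupuyHilado2025, §3.4, §4.9, §4.12] [cite: NeukirchANT1999, Ch. II (5.5)] [claim: Mochizuki2012, status: disputed] -/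
theorem WRow.not_licence_frey73_nineteen_of_not_isSquare (T : Cor22.ThetaVolumeDatumAt (ratPoint (((73 : ℕ) : ℚ) / (5973865915867209 : ℕ))) 19)
    (hns : letI := T.instFieldF; letI := T.instAlgebraF
      ¬ IsSquare (algebraMap (ratPoint (((73 : ℕ) : ℚ) / (5973865915867209 : ℕ))).F T.F ((((73 : ℕ) : ℚ) / (5973865915867209 : ℕ) - 1 : ℚ)))) :
    letI := T.instFieldF; letI := T.instNumberFieldF; letI := T.instAlgebraF; letI := T.instFieldK
    letI := T.instNumberFieldK; letI := T.instAlgebraK; letI := T.instFieldFbar; letI := T.instAlgebraFbar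
    letI := T.instAlgebraKFbar; letI := T.instIsElliptic
    ∀ {logv : PadicLogs T.K} (hlog : LogvAnalytic logv) (M : Type) [Field M] [NumberField M]
      (archPk : ∀ (j : (thetaIndex (pilotDataOfK T.D T.K)).Label) (vQ : (thetaIndex (pilotDataOfK T.D T.K)).VQ),
        Set ((logShellsDH (pilotDataOfK T.D T.K) logv).Packet j vQ))
      (archSub : ∀ (j : (thetaIndex (pilotDataOfK T.D T.K)).Label) (v : (thetaIndex (pilotDataOfK T.D T.K)).V),
        Set ((logShellsDH (pilotDataOfK T.D T.K) logv).Packet j ((thetaIndex (pilotDataOfK T.D T.K)).over v)))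
      (Ψ : ℤ → ∀ v : (thetaIndex (pilotDataOfK T.D T.K)).V, v ∈ (thetaIndex (pilotDataOfK T.D T.K)).Vbad →
        Set ((logShellsDH (pilotDataOfK T.D T.K) logv).StarPacket v))
      (act : ℤ → ∀ v : (thetaIndex (pilotDataOfK T.D T.K)).V, v ∈ (thetaIndex (pilotDataOfK T.D T.K)).Vbad →
        (logShellsDH (pilotDataOfK T.D T.K) logv).StarPacket v → Module.End ℚ ((logShellsDH (pilotDataOfK T.D T.K) logv).StarPacket v))
      (Mmod : ℤ → ∀ j : (thetaIndex (pilotDataOfK T.D T.K)).LabelStar, Set ((logShellsDH (pilotDataOfK T.D T.K) logv).GlobalPacket j.1))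
      (region : ℤ → ∀ j : (thetaIndex (pilotDataOfK T.D T.K)).LabelStar, FinDivisor M → ∀ vQ : (thetaIndex (pilotDataOfK T.D T.K)).VQ,
        Set ((logShellsDH (pilotDataOfK T.D T.K) logv).Packet j.1 vQ))
      (n : ℤ) {HT : Type} {LogLink : HT → HT → Type} {IsFull : ∀ {s t : HT}, LogLink s t → Prop}
      (lat : LGPGaussianLogThetaLattice LogLink IsFull)
      {Frd : Type} {IsoF : Frd → Frd → Type} {Ob : Frd → Type} {realify : Frd → Frd} {Strip : Type}
      {IsoS : Strip → Strip → Type} {Mv : ∀ v : (thetaIndex (pilotDataOfK T.D T.K)).V, v ∈ (thetaIndex (pilotDataOfK T.D T.K)).Vbad → Type}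
      [∀ v h, Monoid (Mv v h)]
      (sig : GlobalLGPFrobenioidSignature (thetaIndex (pilotDataOfK T.D T.K)).lstar (thetaIndex (pilotDataOfK T.D T.K)).V
        (· ∈ (thetaIndex (pilotDataOfK T.D T.K)).Vbad) Frd IsoF Ob realify Strip IsoS Mv)
      (split : SplittingMonoids Mv) {ObΔ : Type} {N : ∀ v : (thetaIndex (pilotDataOfK T.D T.K)).V, v ∈ (thetaIndex (pilotDataOfK T.D T.K)).Vbad → Type}
      [∀ v h, Monoid (N v h)] (qData : QPilotData ObΔ N)
      (tq : ∀ (pp : Nat.Primes) (x : (thetaIndex (pilotDataOfK T.D T.K)).Fibre (.inr pp)),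
        haveI : Fact (pp : ℕ).Prime := ⟨pp.2⟩; kOf (pilotDataOfK T.D T.K) pp.1 x)
      (t : ∀ (pp : Nat.Primes) (_ : Fin (pilotDataOfK T.D T.K).lstar) (x : (thetaIndex (pilotDataOfK T.D T.K)).Fibre (.inr pp)),
        haveI : Fact (pp : ℕ).Prime := ⟨pp.2⟩; kOf (pilotDataOfK T.D T.K) pp.1 x)
      (htq0 : ∀ pp x, tq pp x ≠ 0)
      (htq1 : ∀ (pp : Nat.Primes) (x : (thetaIndex (pilotDataOfK T.D T.K)).Fibre (.inr pp)),
        haveI : Fact (pp : ℕ).Prime := ⟨pp.2⟩; placeOf (pilotDataOfK T.D T.K) pp.1 x ∉ (pilotDataOfK T.D T.K).S → ‖tq pp x‖ = 1)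
      (_ht0 : ∀ pp i x, t pp i x ≠ 0)
      (_ht : ∀ (pp : Nat.Primes) (i : Fin (pilotDataOfK T.D T.K).lstar) (x : (thetaIndex (pilotDataOfK T.D T.K)).Fibre (.inr pp)),
        haveI : Fact (pp : ℕ).Prime := ⟨pp.2⟩
        Real.log ‖t pp i x‖ = -((pilotDataOfK T.D T.K).thetaPilot i (placeOf (pilotDataOfK T.D T.K) pp.1 x)) *
          logNorm T.K (placeOf (pilotDataOfK T.D T.K) pp.1 x) / localDegree T.K (placeOf (pilotDataOfK T.D T.K) pp.1 x))
      (_htq : ∀ (pp : Nat.Primes) (x : (thetaIndex (pilotDataOfK T.D T.K)).Fibre (.inr pp)),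
        haveI : Fact (pp : ℕ).Prime := ⟨pp.2⟩
        Real.log ‖tq pp x‖ = -((pilotDataOfK T.D T.K).qPilot (placeOf (pilotDataOfK T.D T.K) pp.1 x)) *
          logNorm T.K (placeOf (pilotDataOfK T.D T.K) pp.1 x) / localDegree T.K (placeOf (pilotDataOfK T.D T.K) pp.1 x)),
      ¬ Thm311ToCor312.Licence
        (settingPrVolSharp (pilotDataOfK T.D T.K) hlog M archPk archSub Ψ act Mmod region n lat sig split qData tq t htq0 htq1) :=
  WRow.not_licence_frey73_nineteen_of_localType15 T (WRow.absRamificationIdx_frey73_seven_eq_285_of_not_isSquare T hns)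

/-- **`√(λ−1) ∉ F` ⟹ branch C's per-datum antecedent «∃ ρ qK, QPinned ∧ PilotKummerCompatHull» FAILS at `l = 19`** (any columns `col`,
every pair of realising ideles) — abc-iut-W-row-1's `WRow.not_exists_qPinned_and_hull_frey73_nineteen_of_localType15` (p494541) at the exact
type `285`. [cite: Mochizuki2012, IUTchIII Cor. 3.12 Step (xi-d) p. 183, (xi-f) p. 184] [claim: Mochizuki2012, status: disputed] -/
theorem WRow.not_exists_qPinned_and_hull_frey73_nineteen_of_not_isSquare (T : Cor22.ThetaVolumeDatumAt (ratPoint (((73 : ℕ) : ℚ) / (5973865915867209 : ℕ))) 19)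
    (hns : letI := T.instFieldF; letI := T.instAlgebraF
      ¬ IsSquare (algebraMap (ratPoint (((73 : ℕ) : ℚ) / (5973865915867209 : ℕ))).F T.F ((((73 : ℕ) : ℚ) / (5973865915867209 : ℕ) - 1 : ℚ)))) :
    letI := T.instFieldF; letI := T.instNumberFieldF; letI := T.instAlgebraF; letI := T.instFieldK
    letI := T.instNumberFieldK; letI := T.instAlgebraK; letI := T.instFieldFbar; letI := T.instAlgebraFbar
    letI := T.instAlgebraKFbar; letI := T.instIsElliptic
    ∀ {logv : PadicLogs T.K} (hlog : LogvAnalytic logv) (M : Type) [Field M] [NumberField M]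
      (archPk : ∀ (j : (thetaIndex (pilotDataOfK T.D T.K)).Label) (vQ : (thetaIndex (pilotDataOfK T.D T.K)).VQ),
        Set ((logShellsDH (pilotDataOfK T.D T.K) logv).Packet j vQ))
      (archSub : ∀ (j : (thetaIndex (pilotDataOfK T.D T.K)).Label) (v : (thetaIndex (pilotDataOfK T.D T.K)).V),
        Set ((logShellsDH (pilotDataOfK T.D T.K) logv).Packet j ((thetaIndex (pilotDataOfK T.D T.K)).over v)))
      (Ψ : ℤ → ∀ v : (thetaIndex (pilotDataOfK T.D T.K)).V, v ∈ (thetaIndex (pilotDataOfK T.D T.K)).Vbad →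
        Set ((logShellsDH (pilotDataOfK T.D T.K) logv).StarPacket v))
      (act : ℤ → ∀ v : (thetaIndex (pilotDataOfK T.D T.K)).V, v ∈ (thetaIndex (pilotDataOfK T.D T.K)).Vbad →
        (logShellsDH (pilotDataOfK T.D T.K) logv).StarPacket v → Module.End ℚ ((logShellsDH (pilotDataOfK T.D T.K) logv).StarPacket v))
      (Mmod : ℤ → ∀ j : (thetaIndex (pilotDataOfK T.D T.K)).LabelStar, Set ((logShellsDH (pilotDataOfK T.D T.K) logv).GlobalPacket j.1))
      (region : ℤ → ∀ j : (thetaIndex (pilotDataOfK T.D T.K)).LabelStar, FinDivisor M → ∀ vQ : (thetaIndex (pilotDataOfK T.D T.K)).VQ,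
        Set ((logShellsDH (pilotDataOfK T.D T.K) logv).Packet j.1 vQ))
      (n : ℤ) {HT : Type} {LogLink : HT → HT → Type} {IsFull : ∀ {s t : HT}, LogLink s t → Prop}
      (lat : LGPGaussianLogThetaLattice LogLink IsFull)
      {Frd : Type} {IsoF : Frd → Frd → Type} {Ob : Frd → Type} {realify : Frd → Frd} {Strip : Type}
      {IsoS : Strip → Strip → Type} {Mv : ∀ v : (thetaIndex (pilotDataOfK T.D T.K)).V, v ∈ (thetaIndex (pilotDataOfK T.D T.K)).Vbad → Type}
      [∀ v h, Monoid (Mv v h)]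
      (sig : GlobalLGPFrobenioidSignature (thetaIndex (pilotDataOfK T.D T.K)).lstar (thetaIndex (pilotDataOfK T.D T.K)).V
        (· ∈ (thetaIndex (pilotDataOfK T.D T.K)).Vbad) Frd IsoF Ob realify Strip IsoS Mv)
      (split : SplittingMonoids Mv) {ObΔ : Type} {N : ∀ v : (thetaIndex (pilotDataOfK T.D T.K)).V, v ∈ (thetaIndex (pilotDataOfK T.D T.K)).Vbad → Type}
      [∀ v h, Monoid (N v h)] (qData : QPilotData ObΔ N)
      (tq : ∀ (pp : Nat.Primes) (x : (thetaIndex (pilotDataOfK T.D T.K)).Fibre (.inr pp)),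
        haveI : Fact (pp : ℕ).Prime := ⟨pp.2⟩; kOf (pilotDataOfK T.D T.K) pp.1 x)
      (t : ∀ (pp : Nat.Primes) (_ : Fin (pilotDataOfK T.D T.K).lstar) (x : (thetaIndex (pilotDataOfK T.D T.K)).Fibre (.inr pp)),
        haveI : Fact (pp : ℕ).Prime := ⟨pp.2⟩; kOf (pilotDataOfK T.D T.K) pp.1 x)
      (htq0 : ∀ pp x, tq pp x ≠ 0)
      (htq1 : ∀ (pp : Nat.Primes) (x : (thetaIndex (pilotDataOfK T.D T.K)).Fibre (.inr pp)),
        haveI : Fact (pp : ℕ).Prime := ⟨pp.2⟩; placeOf (pilotDataOfK T.D T.K) pp.1 x ∉ (pilotDataOfK T.D T.K).S → ‖tq pp x‖ = 1)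
      (col : ℤ → Column (logShellsDH (pilotDataOfK T.D T.K) logv))
      (_ht0 : ∀ pp i x, t pp i x ≠ 0)
      (_ht : ∀ (pp : Nat.Primes) (i : Fin (pilotDataOfK T.D T.K).lstar) (x : (thetaIndex (pilotDataOfK T.D T.K)).Fibre (.inr pp)),
        haveI : Fact (pp : ℕ).Prime := ⟨pp.2⟩
        Real.log ‖t pp i x‖ = -((pilotDataOfK T.D T.K).thetaPilot i (placeOf (pilotDataOfK T.D T.K) pp.1 x)) *
          logNorm T.K (placeOf (pilotDataOfK T.D T.K) pp.1 x) / localDegree T.K (placeOf (pilotDataOfK T.D T.K) pp.1 x))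
      (_htq : ∀ (pp : Nat.Primes) (x : (thetaIndex (pilotDataOfK T.D T.K)).Fibre (.inr pp)),
        haveI : Fact (pp : ℕ).Prime := ⟨pp.2⟩
        Real.log ‖tq pp x‖ = -((pilotDataOfK T.D T.K).qPilot (placeOf (pilotDataOfK T.D T.K) pp.1 x)) *
          logNorm T.K (placeOf (pilotDataOfK T.D T.K) pp.1 x) / localDegree T.K (placeOf (pilotDataOfK T.D T.K) pp.1 x)),
      ¬ ∃ (ρ : (∀ v : (thetaIndex (pilotDataOfK T.D T.K)).V, v ∈ (thetaIndex (pilotDataOfK T.D T.K)).Vbad →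
              Set ((logShellsDH (pilotDataOfK T.D T.K) logv).StarPacket v)) →
            ∀ (j : (thetaIndex (pilotDataOfK T.D T.K)).Label) (vQ : (thetaIndex (pilotDataOfK T.D T.K)).VQ),
              Set ((logShellsDH (pilotDataOfK T.D T.K) logv).Packet j vQ))
          (qK : ∀ v : (thetaIndex (pilotDataOfK T.D T.K)).V, v ∈ (thetaIndex (pilotDataOfK T.D T.K)).Vbad →
            Set ((logShellsDH (pilotDataOfK T.D T.K) logv).StarPacket v)),
          QPinned ({ toSituation := situationPrVol (pilotDataOfK T.D T.K) hlog M archPk archSub Ψ act Mmod region, col := col } :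
              LatticeSituation (thetaIndex (pilotDataOfK T.D T.K)))
            (settingPrVolSharp (pilotDataOfK T.D T.K) hlog M archPk archSub Ψ act Mmod region n lat sig split qData tq t htq0 htq1) ρ qK ∧
          PilotKummerCompatHull ({ toSituation := situationPrVol (pilotDataOfK T.D T.K) hlog M archPk archSub Ψ act Mmod region, col := col } :
              LatticeSituation (thetaIndex (pilotDataOfK T.D T.K)))
            (settingPrVolSharp (pilotDataOfK T.D T.K) hlog M archPk archSub Ψ act Mmod region n lat sig split qData tq t htq0 htq1) ρ qK :=
  WRow.not_exists_qPinned_and_hull_frey73_nineteen_of_localType15 T (WRow.absRamificationIdx_frey73_seven_eq_285_of_not_isSquare T hns)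

end Summit.ABC.IUTFork.Conditional

end
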